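import Summits.BirchSwinnertonDyer.BirchSwinnertonDyer.Theorems.PrintCf2RubinValueTwoJLKDescentRowOneLocalPlaces
import Summits.BirchSwinnertonDyer.BirchSwinnertonDyer.Theorems.PrintCf2SplitBadTwoCMPrimaryConjugationTransport
import HarnessLib

/-!
# (α3) ROW 1 — `hplaces` on the `D = −7` frame, in the CONDUCTOR-OF-RECORD currency (`hram0`, no `h2`)

Cell `bsd-print-cf2`, width seat `bsd-line-cf2-p1-w3` g20; sequel of `…JLKDescentRowOneLocalPlaces.lean` (this seat); `--supports`
stmt-BirchSwinnertonDyer-24721 `--as helper`, Theses-free.  The discharge `hplaces_of_discr_eq_neg_seven` there displays two frame binders: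
`h2` («every place of `supp(2𝔣)` above `2` is `v` or `v̄`») and `hram` in the `absInertia`/`pairKer` currency of ROW 1's kernel bound.  Here
both are derived from the class frame as the other ROW-1/ROW-2 files state it: `h2` from `[K : ℚ] = 2` and `2 = v v̄`
(`CMPrimes.eq_or_eq_of_two_mem`), and `hram` from the conductor-of-record hypothesis
`hram0 : ∀ u ∈ supp(2𝔣), 2 ∉ u → ∃ δ₀ ∈ I_u, unitChar θ δ₀ ≠ 1` (`ConductorOfRecord.exists_mem_inertia_apply_ne_one_of_mem_suppPF_conductor`,
-w6 g10) — the inertia group `I_u` of the chosen embedding is the image of `absInertia K_u`, it lies in `Gal(K̄/K̃_∞)` because the lines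
`κ₁, κ₂` are unramified outside `v ∌ u`, `v̄ ∌ u`, and `≠ 1` means `= −1` for a quadratic `θ`.

* `hram_of_hram0` — the currency bridge;
* `hplaces_of_discr_eq_neg_seven'` — `hplaces` VERBATIM (`p = 2`, `θ′ = unitChar θ`, pins `(γ₁⁻¹, γ₂⁻¹)`, `e = 2`) from the class frame +
  `hμ` + `hram0` only.

THEOREMS ONLY; no summit statement is proved by this seat; BSD is not proved by any of this.
[cite: JohnsonLeungKings2011, §5.4 Lemma 5.8] [cite: NeukirchANT1999, Ch. I §8 Prop. (8.2), Ch. II §9 Prop. (9.6)]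
-/

noncomputable section

set_option linter.dupNamespace false -- D-0017: single-problem summit, `…BirchSwinnertonDyer.BirchSwinnertonDyer…` repeats a namespace by design
set_option autoImplicit false

open scoped NumberField
open CategoryTheory Function Field IsDedekindDomain NumberField
open Literature.NumberTheory.GaloisRepresentations
open Literature.NumberTheory.GaloisRepresentations.DiscreteGaloisModule
open Literature.NumberTheory.EllipticCurves
open Literature.NumberTheory.EllipticCurves.GreenbergSelmer (decomp inertia)
open Literature.NumberTheory.GaloisCohomology.ShaLayer (locHom)
open Literature.NumberTheory.ComplexMultiplication.EllipticUnits.JohnsonLeungKings2011 (muTwist pairLayerSubgroup suppPF)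
open Literature.NumberTheory.EllipticCurves.KellerYin2024 (unitChar)
open Literature.NumberTheory.ComplexMultiplication.EllipticUnits.JohnsonLeungKings2011.ClassGroupRow (unitChar_eq_one_or_eq_neg_one_of_sq)
open _root_.TopRep _root_.ContinuousCohomology

namespace Summit.BirchSwinnertonDyer.BirchSwinnertonDyer.Theorems.PrintCf2.JLKDescent

variable {K : Type} [Field K] [NumberField K] {κ₁ κ₂ : ZpExtension K 2}
  (θ : FramedGaloisRep K (padicCoeffIntegers (∅ : Set (PadicAlgCl 2))) 1) (hθ2 : ∀ σ : absoluteGaloisGroup K, θ σ ^ 2 = 1)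
  {𝔣 : Ideal (𝓞 K)}

include hθ2 in
/-- **The tame-inertia currency bridge.**  On the frame (`2 ∈ v`, `2 ∈ v̄`, `κ₁` unramified outside `v`, `κ₂` unramified outside `v̄`,
`θ` quadratic), the conductor-of-record hypothesis `∃ δ₀ ∈ I_u, unitChar θ δ₀ ≠ 1` at a place `u ∌ 2` yields an element `i₀` of the local
inertia group `absInertia K_u` with `res_u i₀ ∈ Gal(K̄/K̃_∞)` and `unitChar θ (res_u i₀) = −1`.
[cite: NeukirchANT1999, Ch. II §9 Prop. (9.6)] [cite: Washington1997, §13.1] -/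
theorem hram_of_hram0 {v vbar : HeightOneSpectrum (𝓞 K)} (hv : ((2 : ℕ) : 𝓞 K) ∈ v.asIdeal) (hvbar : ((2 : ℕ) : 𝓞 K) ∈ vbar.asIdeal)
    (hκ₂ : κ₂.IsUnramifiedOutside vbar) (hκ₁ : κ₁.IsUnramifiedOutside v)
    (hram0 : ∀ u ∈ suppPF 2 𝔣, ((2 : ℕ) : 𝓞 K) ∉ u.asIdeal → ∃ δ₀ ∈ inertia u, unitChar θ δ₀ ≠ 1) :
    ∀ w ∈ suppPF 2 𝔣, ((2 : ℕ) : 𝓞 K) ∉ w.asIdeal → ∃ i₀ ∈ absInertia (w.adicCompletion K),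
      absGaloisRestrict K (w.adicCompletion K) i₀ ∈ ZpExtension.pairKer κ₁ κ₂ ∧ unitChar θ (absGaloisRestrict K (w.adicCompletion K) i₀) = -1 := by
  intro w hw h2w
  obtain ⟨δ₀, hδ₀, hne1⟩ := hram0 w hw h2w
  obtain ⟨i₀, hi₀, rfl⟩ := Subgroup.mem_map.mp hδ₀
  have hwv : w ≠ v := fun h => h2w (h ▸ hv)
  have hwvbar : w ≠ vbar := fun h => h2w (h ▸ hvbar)
  refine ⟨i₀, hi₀, ZpExtension.mem_pairKer_iff.mpr ⟨?_, ?_⟩, ?_⟩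
  · exact ZpExtension.mem_kerSubgroup.mp ((ZpExtension.isUnramifiedOutside_iff κ₁ v).mp hκ₁ w hwv hδ₀)
  · exact ZpExtension.mem_kerSubgroup.mp ((ZpExtension.isUnramifiedOutside_iff κ₂ vbar).mp hκ₂ w hwvbar hδ₀)
  · exact (unitChar_eq_one_or_eq_neg_one_of_sq hθ2 _).resolve_left hne1

include hθ2 in
/-- **`hplaces` on the `D = −7` class frame, conductor-of-record currency**: as `hplaces_of_discr_eq_neg_seven`, with `h2` derived from
`[K : ℚ] = 2`, `2 = v v̄` (`CMPrimes.eq_or_eq_of_two_mem`) and the tame hypothesis in the form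
`hram0 : ∀ u ∈ supp(2𝔣), 2 ∉ u → ∃ δ₀ ∈ I_u, unitChar θ δ₀ ≠ 1` (`hram_of_hram0`). [cite: JohnsonLeungKings2011, §5.4 Lemma 5.8 (proof)] [cite: NeukirchANT1999, Ch. I §8 Prop. (8.2)] -/
theorem hplaces_of_discr_eq_neg_seven' (hμ : ∀ k : ℕ, ramificationSubgroup K (suppPF 2 𝔣) ≤ ContinuousRep.ker (muTwist 2 (unitChar θ) k))
    (hK : IsImaginaryQuadratic K) (h2K : ¬ 2 ∣ NumberField.classNumber K)
    (hdisc : NumberField.discr K = -7) {v vbar : HeightOneSpectrum (𝓞 K)} (hv : ((2 : ℕ) : 𝓞 K) ∈ v.asIdeal)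
    (hvbar : ((2 : ℕ) : 𝓞 K) ∈ vbar.asIdeal) (hne : vbar ≠ v) {γ₁ γ₂ : absoluteGaloisGroup K}
    (hpair : ZpExtension.IsTopGeneratorPair κ₁ κ₂ γ₁ γ₂) (hκ₂ : κ₂.IsUnramifiedOutside vbar) (hκ₁ : κ₁.IsUnramifiedOutside v)
    (hγ₁ : γ₁ ∈ inertia v) (hγ₂ : γ₂ ∈ inertia vbar)
    (hram0 : ∀ u ∈ suppPF 2 𝔣, ((2 : ℕ) : 𝓞 K) ∉ u.asIdeal → ∃ δ₀ ∈ inertia u, unitChar θ δ₀ ≠ 1) :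
    ∀ w ∈ suppPF 2 𝔣,
      (∀ (n k : ℕ) (c : continuousCohomology 2 (subgroupRep
        (TopRep.res (locHom (S := suppPF 2 𝔣) w : absoluteGaloisGroup (w.adicCompletion K) →* GaloisGroupUnramifiedOutside K (suppPF 2 𝔣))
          ((muTwist 2 (unitChar θ) k).quotientInvariants (ramificationSubgroup K (suppPF 2 𝔣))).toTopRep)
        (((pairLayerSubgroup κ₁ κ₂ n).map (toUnramifiedQuot K (suppPF 2 𝔣))).comap
          (locHom (S := suppPF 2 𝔣) w : absoluteGaloisGroup (w.adicCompletion K) →* GaloisGroupUnramifiedOutside K (suppPF 2 𝔣))))),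
        2 ^ 2 • c = 0) ∨
      ((∃ (δ : absoluteGaloisGroup (w.adicCompletion K)) (h : absoluteGaloisGroup K) (u : ℤ),
          h ∈ ZpExtension.pairKer κ₁ κ₂ ∧ γ₁⁻¹ = absGaloisRestrict K (w.adicCompletion K) δ * h ∧
          ∀ (n k : ℕ) (c : continuousCohomology 2 (subgroupRep
            (TopRep.res (locHom (S := suppPF 2 𝔣) w : absoluteGaloisGroup (w.adicCompletion K) →* GaloisGroupUnramifiedOutside K (suppPF 2 𝔣))
              ((muTwist 2 (unitChar θ) k).quotientInvariants (ramificationSubgroup K (suppPF 2 𝔣))).toTopRep)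
            (((pairLayerSubgroup κ₁ κ₂ n).map (toUnramifiedQuot K (suppPF 2 𝔣))).comap
              (locHom (S := suppPF 2 𝔣) w : absoluteGaloisGroup (w.adicCompletion K) →* GaloisGroupUnramifiedOutside K (suppPF 2 𝔣))))),
            2 ^ 2 • ((conjMap (TopRep.res (locHom (S := suppPF 2 𝔣) w : absoluteGaloisGroup (w.adicCompletion K) →*
                GaloisGroupUnramifiedOutside K (suppPF 2 𝔣)) ((muTwist 2 (unitChar θ) k).quotientInvariants (ramificationSubgroup K (suppPF 2 𝔣))).toTopRep)
              (((pairLayerSubgroup κ₁ κ₂ n).map (toUnramifiedQuot K (suppPF 2 𝔣))).comap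
                (locHom (S := suppPF 2 𝔣) w : absoluteGaloisGroup (w.adicCompletion K) →* GaloisGroupUnramifiedOutside K (suppPF 2 𝔣))) δ 2).hom c -
              u • c) = 0) ∧
        (∃ (δ : absoluteGaloisGroup (w.adicCompletion K)) (h : absoluteGaloisGroup K) (u : ℤ),
          h ∈ ZpExtension.pairKer κ₁ κ₂ ∧ γ₂⁻¹ = absGaloisRestrict K (w.adicCompletion K) δ * h ∧
          ∀ (n k : ℕ) (c : continuousCohomology 2 (subgroupRep
            (TopRep.res (locHom (S := suppPF 2 𝔣) w : absoluteGaloisGroup (w.adicCompletion K) →* GaloisGroupUnramifiedOutside K (suppPF 2 𝔣))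
              ((muTwist 2 (unitChar θ) k).quotientInvariants (ramificationSubgroup K (suppPF 2 𝔣))).toTopRep)
            (((pairLayerSubgroup κ₁ κ₂ n).map (toUnramifiedQuot K (suppPF 2 𝔣))).comap
              (locHom (S := suppPF 2 𝔣) w : absoluteGaloisGroup (w.adicCompletion K) →* GaloisGroupUnramifiedOutside K (suppPF 2 𝔣))))),
            2 ^ 2 • ((conjMap (TopRep.res (locHom (S := suppPF 2 𝔣) w : absoluteGaloisGroup (w.adicCompletion K) →*
                GaloisGroupUnramifiedOutside K (suppPF 2 𝔣)) ((muTwist 2 (unitChar θ) k).quotientInvariants (ramificationSubgroup K (suppPF 2 𝔣))).toTopRep)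
              (((pairLayerSubgroup κ₁ κ₂ n).map (toUnramifiedQuot K (suppPF 2 𝔣))).comap
                (locHom (S := suppPF 2 𝔣) w : absoluteGaloisGroup (w.adicCompletion K) →* GaloisGroupUnramifiedOutside K (suppPF 2 𝔣))) δ 2).hom c -
              u • c) = 0)) :=
  hplaces_of_discr_eq_neg_seven θ hθ2 hμ hK h2K hdisc hv hvbar hne hpair hκ₂ hκ₁ hγ₁ hγ₂
    (fun _ _ hw2 => CMPrimes.eq_or_eq_of_two_mem (K := K) hK.1 hv hvbar hne hw2) (hram_of_hram0 θ hθ2 hv hvbar hκ₂ hκ₁ hram0)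

end Summit.BirchSwinnertonDyer.BirchSwinnertonDyer.Theorems.PrintCf2.JLKDescent

end
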